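import Mathlib
import HarnessLib
import Summits.NavierStokesRegularity.NavierStokesRegularity.Theorems.PoloidalWindowDoorPoloidalWindowRigidityHorizontalFlatPast
import Summits.NavierStokesRegularity.NavierStokesRegularity.Theorems.PoloidalWindowDoorPoloidalWindowRigidityConstantShear
import Summits.NavierStokesRegularity.NavierStokesRegularity.Theorems.PoloidalWindowDoorPoloidalWindowRigidityProportionalShear

/-!
# Route `PoloidalWindowDoor`, crux `PoloidalWindowRigidity` (K2, stmt-NavierStokesRegularity-19708), line «lrc-jet» v2 —
# THE CONSTANT-SHEAR DOOR AT `t = −∞`: time-dependent proportional shear whose slope CONVERGES backward in time is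
# trivial (insurance stratum (L) of `stub_tv`, mechanism-free)

Cell ns-regularity-ideate, seat ns-poloidal-K2-p3 gen 4 (stub-worker under the K2 lead ns-poloidal-K2-p1 g4; file landed
`--supports stmt-NavierStokesRegularity-19708` as a helper; task (L) of the lead's 09:47Z wave).

The stratum (TV) of the lrc-jet dichotomy (this seat's `…TimeShear`, `…TimeShearPressure`; refuter1 K-a″) — every slice
`s < 0` proportional-shear, `∂₂v_b(s,·) = μ(s) ∂_b v₂(s,·)` (`b = 0,1`) — splits by the behaviour of `μ(τ)` as `τ → −∞`:
growth `|μ| → ∞` is the lead's flat door at `−∞` (`…HorizontalFlatPast`, p519353); bounded along a sequence is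
ns-poloidal-K2-p2's M12 run (bricks `…TimeShearVariance/Decay/Test`).  This file is the mechanism-free INSURANCE for the
convergent case, by the lead's zoom-out template with the flatness step replaced by constant shear:

* `tendsto_zero_of_timeShear_tendsto` — class + poloidal + all-slices proportional shear with `μ(τ) → μ⋆ ∈ ℝ` as
  `τ → −∞` ⇒ `sup_x √(−t)‖v(t,x)‖ → 0` as `t → −∞`.  Proof: at bad points the recentred parabolic zooms are poloidal
  members of `𝔓(C)` whose slice `s` is proportional-shear with slope `μ(c_k² s)`; KNSS compactness WITH GRADIENTS
  (`exists_tendsto_of_isTypeIAncientMild_seq`) and `μ(c_k² s) → μ⋆` (products of convergent sequences) make the limit `W`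
  a poloidal class member with CONSTANT shear `μ⋆` on every slice and `‖W(−1,0)‖ ≥ ε`; but the constant-shear stratum is
  empty for every real `μ⋆` (ns-poloidal-K2-p2 `eq_zero_of_constantShear`, `μ⋆ < 1`; ns-poloidal-K2-p1
  `eq_zero_of_proportionalShear`, `μ⋆ > 0`) — contradiction.
* `eq_zero_of_timeShear_tendsto` / `nonflatLiouville_of_timeShear_tendsto` — hence `v ≡ 0` (K2-p2's
  `…ZoomOut.eq_zero_of_tendsto_zero`).

WHAT THIS IS NOT: not a claim about Navier–Stokes regularity, not LRC″, not `stub_tv` — one settled asymptotic sub-stratum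
of (TV) (bears_on LADDER-NS N0, rung N0-LocalTubeDoorPoloidal).
-/

noncomputable section

-- the summit and its single sub-problem share the name (CONVENTIONS §1), as in every Theorems file
set_option linter.dupNamespace false

namespace Summit.NavierStokesRegularity.NavierStokesRegularity.Theorems.PoloidalWindowDoorPoloidalWindowRigidityTimeShearLimitPast

open MeasureTheory Set Function Filter Topology
open scoped RealInnerProductSpace InnerProductSpace
open Literature.Analysis Literature.Analysis.FluidPDE
open Summit.NavierStokesRegularity.NavierStokesRegularity.Theorems
open Summit.NavierStokesRegularity.NavierStokesRegularity.Theorems.PoloidalWindowDoorPoloidalWindowRigidityPoloidalExtremal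
open Summit.NavierStokesRegularity.NavierStokesRegularity.Theorems.PoloidalWindowDoorPoloidalWindowRigidityZoomOut
open Summit.NavierStokesRegularity.NavierStokesRegularity.Theorems.PoloidalWindowDoorPoloidalWindowRigidityWindow
open Summit.NavierStokesRegularity.NavierStokesRegularity.Theorems.PoloidalWindowDoorPoloidalWindowRigidityFlat
open Summit.NavierStokesRegularity.NavierStokesRegularity.Theorems.PoloidalWindowDoorPoloidalWindowRigidityConstantShear
open Summit.NavierStokesRegularity.NavierStokesRegularity.Theorems.PoloidalWindowDoorPoloidalWindowRigidityProportionalShear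

variable {C : ℝ} {v : ℝ → EuclideanSpace ℝ (Fin 3) → EuclideanSpace ℝ (Fin 3)}

/-- **Convergent slope at `−∞` ⇒ small at `−∞`.**  Let `v` be a profile of the route's Type-I class, poloidal along `e₃`
on every slice, every slice of which is proportional-shear with a slope function `μ` that CONVERGES backward in time,
`μ(τ) → μ⋆` as `τ → −∞`.  Then `sup_x √(−t)‖v(t,x)‖ → 0` as `t → −∞`. -/
theorem tendsto_zero_of_timeShear_tendsto (hrate : HasTypeITimeDecay C v)
    (hcont : ContinuousOn (uncurry v) (Iio (0 : ℝ) ×ˢ univ))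
    (hmild : ∀ s t : ℝ, s < t → t < 0 → ∀ x,
      v t x = UnboundedOperators.heatExtension (v s) (t - s) x - oseenDuhamel 1 s v v t x)
    (hdiv : ∀ t < 0, VectorCalculus.IsDivFree (v t))
    (hpol : ∀ s < 0, ∀ y, ⟪curl (v s) y, EuclideanSpace.single 2 (1 : ℝ)⟫_ℝ = 0) {μ : ℝ → ℝ}
    (hslope : ∀ s < 0, ∀ y, ∀ b : Fin 3, b ≠ 2 →
      fderiv ℝ (v s) y (EuclideanSpace.single 2 1) b = μ s * fderiv ℝ (v s) y (EuclideanSpace.single b 1) 2)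
    {μstar : ℝ} (hμlim : Tendsto μ atBot (𝓝 μstar)) :
    ∀ ε : ℝ, 0 < ε → ∃ T : ℝ, T < 0 ∧ ∀ t < T, ∀ x, Real.sqrt (-t) * ‖v t x‖ ≤ ε := by
  intro ε hε
  by_contra hcon
  push Not at hcon
  -- ## a bad sequence `t_k < −(k+1)`, `x_k`
  have hch : ∀ k : ℕ, ∃ t : ℝ, t < -((k : ℝ) + 1) ∧ ∃ x, ε < Real.sqrt (-t) * ‖v t x‖ := fun k =>
    hcon _ (by have : (0 : ℝ) ≤ k := Nat.cast_nonneg k; linarith)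
  choose tk htk xk hxk using hch
  have htk0 : ∀ k, tk k < 0 := fun k => by
    have := htk k; have : (0 : ℝ) ≤ k := Nat.cast_nonneg k; linarith
  set c : ℕ → ℝ := fun k => Real.sqrt (-tk k) with hcdef
  have hc0 : ∀ k, 0 < c k := fun k => Real.sqrt_pos.2 (neg_pos.2 (htk0 k))
  have hc2 : ∀ k, c k ^ 2 = -tk k := fun k => Real.sq_sqrt (neg_pos.2 (htk0 k)).le
  have hcinf : Tendsto c atTop atTop := by
    have h1 : Tendsto (fun k : ℕ => Real.sqrt ((k : ℝ) + 1)) atTop atTop :=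
      Real.tendsto_sqrt_atTop.comp (tendsto_natCast_atTop_atTop.atTop_add tendsto_const_nhds)
    refine tendsto_atTop_mono (fun k => ?_) h1
    exact Real.sqrt_le_sqrt (by have := htk k; linarith)
  -- ## the recentred zooms: poloidal members of the KNSS class `𝔓(C)`
  have hA : IsTypeIAncientMild C v := isTypeIAncientMild_of_class hrate hcont hmild hdiv
  set vk : ℕ → ℝ → EuclideanSpace ℝ (Fin 3) → EuclideanSpace ℝ (Fin 3) := fun k =>
    nsRescale (c k) (fun t x => v t (xk k + x)) with hvk_def
  have hvk : ∀ k, IsTypeIAncientMild C (vk k) := fun k =>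
    isTypeIAncientMild_nsRescale (isTypeIAncientMild_translate hA (xk k)) (hc0 k)
  have hvkpol : ∀ k, ∀ s < 0, ∀ y, ⟪curl (vk k s) y, EuclideanSpace.single 2 (1 : ℝ)⟫_ℝ = 0 := fun k =>
    poloidal_nsRescale (poloidal_translate hpol (xk k)) (hc0 k)
  have hval : ∀ k, ‖vk k (-1) 0‖ = Real.sqrt (-tk k) * ‖v (tk k) (xk k)‖ := fun k => by
    simp only [hvk_def]
    rw [nsRescale_apply, smul_zero, add_zero, mul_neg_one, hc2 k, neg_neg, norm_smul,
      Real.norm_of_nonneg (Real.sqrt_nonneg _)]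
  -- the zoomed slices are proportional-shear with slope `μ(c_k² s)`
  have hvkshear : ∀ k, ∀ s < 0, ∀ y, ∀ b : Fin 3, b ≠ 2 →
      fderiv ℝ (vk k s) y (EuclideanSpace.single 2 1) b =
        μ (c k ^ 2 * s) * fderiv ℝ (vk k s) y (EuclideanSpace.single b 1) 2 := by
    intro k s hs y b hb
    have hσ0 : c k ^ 2 * s < 0 := mul_neg_of_pos_of_neg (pow_pos (hc0 _) 2) hs
    have hD : fderiv ℝ (vk k s) y = c k ^ 2 • fderiv ℝ (v (c k ^ 2 * s)) (xk k + c k • y) := by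
      simp only [hvk_def]
      rw [fderiv_nsRescale_slice, fderiv_translate]
    rw [hD]
    simp only [_root_.smul_apply, PiLp.smul_apply, smul_eq_mul]
    rw [hslope _ hσ0 _ b hb]
    ring
  -- ## KNSS compactness, fields AND gradients
  obtain ⟨φ, hφ, W, hW, hpt, hDpt, -, -⟩ := exists_tendsto_of_isTypeIAncientMild_seq C hvk
  have hWpol : ∀ s < 0, ∀ y, ⟪curl (W s) y, EuclideanSpace.single 2 (1 : ℝ)⟫_ℝ = 0 := fun s hs y =>
    poloidal_of_tendsto (hDpt s hs y) fun j => hvkpol (φ j) s hs y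
  -- the limit is not small at the hot spot
  have hnorm : ε ≤ ‖W (-1) 0‖ := by
    refine ge_of_tendsto ((hpt (-1) (by norm_num) 0).norm) (Eventually.of_forall fun j => ?_)
    rw [hval]
    exact (hxk (φ j)).le
  -- ## the limit has CONSTANT shear `μ⋆` on every slice
  have hWshear : ∀ s < 0, ∀ y, ∀ b : Fin 3, b ≠ 2 →
      fderiv ℝ (W s) y (EuclideanSpace.single 2 1) b = μstar * fderiv ℝ (W s) y (EuclideanSpace.single b 1) 2 := by
    intro s hs y b hb
    have hs' : 0 < -s := neg_pos.2 hs
    -- the two scalar sequences and their limits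
    have hentry : ∀ (e : EuclideanSpace ℝ (Fin 3)) (i : Fin 3),
        Tendsto (fun j => fderiv ℝ (vk (φ j) s) y e i) atTop (𝓝 (fderiv ℝ (W s) y e i)) := by
      intro e i
      have h1 : Tendsto (fun j => fderiv ℝ (vk (φ j) s) y e) atTop (𝓝 (fderiv ℝ (W s) y e)) :=
        ((ContinuousLinearMap.apply ℝ (EuclideanSpace ℝ (Fin 3)) e).continuous.tendsto _).comp (hDpt s hs y)
      exact ((EuclideanSpace.proj (𝕜 := ℝ) i).continuous.tendsto _).comp h1
    have hL := hentry (EuclideanSpace.single 2 1) b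
    have hR := hentry (EuclideanSpace.single b 1) 2
    -- the zoomed times `c_j² s → −∞`, so `μ(c_j² s) → μ⋆`
    have hσ : Tendsto (fun j => c (φ j) ^ 2 * s) atTop atBot := by
      have h1 : Tendsto (fun j => c (φ j) ^ 2 * (-s)) atTop atTop :=
        Tendsto.atTop_mul_const hs' ((tendsto_pow_atTop two_ne_zero).comp (hcinf.comp hφ.tendsto_atTop))
      have h2 := tendsto_neg_atTop_atBot.comp h1
      refine h2.congr fun j => ?_
      simp only [Function.comp_apply]
      ring
    have hμj : Tendsto (fun j => μ (c (φ j) ^ 2 * s)) atTop (𝓝 μstar) := hμlim.comp hσ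
    have hR' : Tendsto (fun j => fderiv ℝ (vk (φ j) s) y (EuclideanSpace.single 2 1) b) atTop
        (𝓝 (μstar * fderiv ℝ (W s) y (EuclideanSpace.single b 1) 2)) :=
      (hμj.mul hR).congr fun j => (hvkshear (φ j) s hs y b hb).symm
    exact tendsto_nhds_unique hL hR'
  -- ## so the limit vanishes (constant-shear stratum, every real `μ⋆`) — contradiction
  have hW0 : ∀ t < 0, ∀ x, W t x = 0 := by
    rcases lt_or_ge μstar 1 with hμ | hμ
    · exact eq_zero_of_constantShear hW.hasTypeITimeDecay hW.continuousOn_uncurry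
        (fun s t hst ht x => hW.mild_eq_heatExtension hst ht x) (fun t ht => hW.isDivFree ht) hWpol hμ hWshear
    · exact eq_zero_of_proportionalShear hW.hasTypeITimeDecay hW.continuousOn_uncurry
        (fun s t hst ht x => hW.mild_eq_heatExtension hst ht x) (fun t ht => hW.isDivFree ht) hWpol
        (zero_lt_one.trans_le hμ) fun s hs y => ⟨hWshear s hs y 0 (by decide), hWshear s hs y 1 (by decide)⟩
  have h0 : W (-1) 0 = 0 := hW0 (-1) (by norm_num) 0
  rw [h0, norm_zero] at hnorm
  linarith

/-- **THE CONSTANT-SHEAR DOOR AT `t = −∞` (profiles).**  A profile of the route's Type-I class, poloidal along `e₃`,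
every slice of which is proportional-shear (`∂₂v_b(s,·) = μ(s)∂_b v₂(s,·)`, `b = 0,1`) with `μ(τ) → μ⋆ ∈ ℝ` as
`τ → −∞`, vanishes identically. -/
theorem eq_zero_of_timeShear_tendsto (hrate : HasTypeITimeDecay C v)
    (hcont : ContinuousOn (uncurry v) (Iio (0 : ℝ) ×ˢ univ))
    (hmild : ∀ s t : ℝ, s < t → t < 0 → ∀ x,
      v t x = UnboundedOperators.heatExtension (v s) (t - s) x - oseenDuhamel 1 s v v t x)
    (hdiv : ∀ t < 0, VectorCalculus.IsDivFree (v t))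
    (hpol : ∀ s < 0, ∀ y, ⟪curl (v s) y, EuclideanSpace.single 2 (1 : ℝ)⟫_ℝ = 0) {μ : ℝ → ℝ}
    (hslope : ∀ s < 0, ∀ y, ∀ b : Fin 3, b ≠ 2 →
      fderiv ℝ (v s) y (EuclideanSpace.single 2 1) b = μ s * fderiv ℝ (v s) y (EuclideanSpace.single b 1) 2)
    {μstar : ℝ} (hμlim : Tendsto μ atBot (𝓝 μstar)) :
    ∀ t < 0, ∀ x, v t x = 0 :=
  eq_zero_of_tendsto_zero hrate hcont hmild
    (tendsto_zero_of_timeShear_tendsto hrate hcont hmild hdiv hpol hslope hμlim)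

/-- The constant-shear door at `t = −∞`: not backward-singular. -/
theorem nonflatLiouville_of_timeShear_tendsto (hrate : HasTypeITimeDecay C v)
    (hcont : ContinuousOn (uncurry v) (Iio (0 : ℝ) ×ˢ univ))
    (hmild : ∀ s t : ℝ, s < t → t < 0 → ∀ x,
      v t x = UnboundedOperators.heatExtension (v s) (t - s) x - oseenDuhamel 1 s v v t x)
    (hdiv : ∀ t < 0, VectorCalculus.IsDivFree (v t))
    (hpol : ∀ s < 0, ∀ y, ⟪curl (v s) y, EuclideanSpace.single 2 (1 : ℝ)⟫_ℝ = 0) {μ : ℝ → ℝ}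
    (hslope : ∀ s < 0, ∀ y, ∀ b : Fin 3, b ≠ 2 →
      fderiv ℝ (v s) y (EuclideanSpace.single 2 1) b = μ s * fderiv ℝ (v s) y (EuclideanSpace.single b 1) 2)
    {μstar : ℝ} (hμlim : Tendsto μ atBot (𝓝 μstar)) :
    ¬ IsBackwardSingularPoint v 0 :=
  not_backwardSingular_of_zero (eq_zero_of_timeShear_tendsto hrate hcont hmild hdiv hpol hslope hμlim)

/-! ### Slowly varying slope (the lead's sharpened (L), K2-p1 g4 10:13Z) -/

/-- **Slowly varying, bounded slope at `−∞` ⇒ small at `−∞`.**  Let `v` be a profile of the route's Type-I class,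
poloidal along `e₃`, every slice of which is proportional-shear with a slope function `μ` that is BOUNDED on a far-past
tail (`|μ(τ)| ≤ M` for `τ < T₀`) and SLOWLY VARYING under dilations: for all `s₁, s₂ < 0`,
`μ(c s₁) − μ(c s₂) → 0` as `c → +∞` (a convergent slope is the special case).  Then `sup_x √(−t)‖v(t,x)‖ → 0` as
`t → −∞`: along a subsequence of bad times the slopes `μ(t_k)` converge (Bolzano–Weierstrass), slow variation transports
the limit `μ⋆` to every zoomed slice, and the zoom-out limit has constant shear `μ⋆`. -/
theorem tendsto_zero_of_timeShear_slowlyVarying (hrate : HasTypeITimeDecay C v)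
    (hcont : ContinuousOn (uncurry v) (Iio (0 : ℝ) ×ˢ univ))
    (hmild : ∀ s t : ℝ, s < t → t < 0 → ∀ x,
      v t x = UnboundedOperators.heatExtension (v s) (t - s) x - oseenDuhamel 1 s v v t x)
    (hdiv : ∀ t < 0, VectorCalculus.IsDivFree (v t))
    (hpol : ∀ s < 0, ∀ y, ⟪curl (v s) y, EuclideanSpace.single 2 (1 : ℝ)⟫_ℝ = 0) {μ : ℝ → ℝ}
    (hslope : ∀ s < 0, ∀ y, ∀ b : Fin 3, b ≠ 2 →
      fderiv ℝ (v s) y (EuclideanSpace.single 2 1) b = μ s * fderiv ℝ (v s) y (EuclideanSpace.single b 1) 2)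
    {M T₀ : ℝ} (hbdd : ∀ τ < T₀, |μ τ| ≤ M)
    (hslow : ∀ s₁ s₂ : ℝ, s₁ < 0 → s₂ < 0 → Tendsto (fun c : ℝ => μ (c * s₁) - μ (c * s₂)) atTop (𝓝 0)) :
    ∀ ε : ℝ, 0 < ε → ∃ T : ℝ, T < 0 ∧ ∀ t < T, ∀ x, Real.sqrt (-t) * ‖v t x‖ ≤ ε := by
  intro ε hε
  by_contra hcon
  push Not at hcon
  -- ## a bad sequence `t_k < min(−(k+1), T₀)`, `x_k`
  have hch : ∀ k : ℕ, ∃ t : ℝ, t < min (-((k : ℝ) + 1)) T₀ ∧ ∃ x, ε < Real.sqrt (-t) * ‖v t x‖ := fun k =>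
    hcon _ (lt_of_le_of_lt (min_le_left _ _) (by have : (0 : ℝ) ≤ k := Nat.cast_nonneg k; linarith))
  choose tk₀ htk₀ xk₀ hxk₀ using hch
  -- ## Bolzano–Weierstrass for the bounded slopes `μ(t_k)`
  have hμbd : ∀ k, μ (tk₀ k) ∈ Icc (-M) M := fun k => by
    have h := hbdd (tk₀ k) (lt_of_lt_of_le (htk₀ k) (min_le_right _ _))
    exact ⟨(abs_le.1 h).1, (abs_le.1 h).2⟩
  obtain ⟨μstar, -, ψ, hψ, hμψ⟩ := tendsto_subseq_of_bounded (Metric.isBounded_Icc (-M) M) hμbd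
  set tk : ℕ → ℝ := fun k => tk₀ (ψ k) with htkdef
  set xk : ℕ → EuclideanSpace ℝ (Fin 3) := fun k => xk₀ (ψ k) with hxkdef
  have hμtk : Tendsto (fun k => μ (tk k)) atTop (𝓝 μstar) := hμψ
  have htk : ∀ k, tk k < -((k : ℝ) + 1) := fun k => by
    have h1 : tk₀ (ψ k) < -((ψ k : ℝ) + 1) := lt_of_lt_of_le (htk₀ (ψ k)) (min_le_left _ _)
    have h2 : (k : ℝ) ≤ ψ k := by exact_mod_cast hψ.id_le k
    simp only [htkdef]; linarith
  have hxk : ∀ k, ε < Real.sqrt (-tk k) * ‖v (tk k) (xk k)‖ := fun k => hxk₀ (ψ k)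
  have htk0 : ∀ k, tk k < 0 := fun k => by
    have := htk k; have : (0 : ℝ) ≤ k := Nat.cast_nonneg k; linarith
  set c : ℕ → ℝ := fun k => Real.sqrt (-tk k) with hcdef
  have hc0 : ∀ k, 0 < c k := fun k => Real.sqrt_pos.2 (neg_pos.2 (htk0 k))
  have hc2 : ∀ k, c k ^ 2 = -tk k := fun k => Real.sq_sqrt (neg_pos.2 (htk0 k)).le
  have hcinf : Tendsto c atTop atTop := by
    have h1 : Tendsto (fun k : ℕ => Real.sqrt ((k : ℝ) + 1)) atTop atTop :=
      Real.tendsto_sqrt_atTop.comp (tendsto_natCast_atTop_atTop.atTop_add tendsto_const_nhds)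
    refine tendsto_atTop_mono (fun k => ?_) h1
    exact Real.sqrt_le_sqrt (by have := htk k; linarith)
  -- ## the recentred zooms: poloidal members of the KNSS class `𝔓(C)`
  have hA : IsTypeIAncientMild C v := isTypeIAncientMild_of_class hrate hcont hmild hdiv
  set vk : ℕ → ℝ → EuclideanSpace ℝ (Fin 3) → EuclideanSpace ℝ (Fin 3) := fun k =>
    nsRescale (c k) (fun t x => v t (xk k + x)) with hvk_def
  have hvk : ∀ k, IsTypeIAncientMild C (vk k) := fun k =>
    isTypeIAncientMild_nsRescale (isTypeIAncientMild_translate hA (xk k)) (hc0 k)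
  have hvkpol : ∀ k, ∀ s < 0, ∀ y, ⟪curl (vk k s) y, EuclideanSpace.single 2 (1 : ℝ)⟫_ℝ = 0 := fun k =>
    poloidal_nsRescale (poloidal_translate hpol (xk k)) (hc0 k)
  have hval : ∀ k, ‖vk k (-1) 0‖ = Real.sqrt (-tk k) * ‖v (tk k) (xk k)‖ := fun k => by
    simp only [hvk_def]
    rw [nsRescale_apply, smul_zero, add_zero, mul_neg_one, hc2 k, neg_neg, norm_smul,
      Real.norm_of_nonneg (Real.sqrt_nonneg _)]
  -- the zoomed slices are proportional-shear with slope `μ(c_k² s)`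
  have hvkshear : ∀ k, ∀ s < 0, ∀ y, ∀ b : Fin 3, b ≠ 2 →
      fderiv ℝ (vk k s) y (EuclideanSpace.single 2 1) b =
        μ (c k ^ 2 * s) * fderiv ℝ (vk k s) y (EuclideanSpace.single b 1) 2 := by
    intro k s hs y b hb
    have hσ0 : c k ^ 2 * s < 0 := mul_neg_of_pos_of_neg (pow_pos (hc0 _) 2) hs
    have hD : fderiv ℝ (vk k s) y = c k ^ 2 • fderiv ℝ (v (c k ^ 2 * s)) (xk k + c k • y) := by
      simp only [hvk_def]
      rw [fderiv_nsRescale_slice, fderiv_translate]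
    rw [hD]
    simp only [_root_.smul_apply, PiLp.smul_apply, smul_eq_mul]
    rw [hslope _ hσ0 _ b hb]
    ring
  -- ## KNSS compactness, fields AND gradients
  obtain ⟨φ, hφ, W, hW, hpt, hDpt, -, -⟩ := exists_tendsto_of_isTypeIAncientMild_seq C hvk
  have hWpol : ∀ s < 0, ∀ y, ⟪curl (W s) y, EuclideanSpace.single 2 (1 : ℝ)⟫_ℝ = 0 := fun s hs y =>
    poloidal_of_tendsto (hDpt s hs y) fun j => hvkpol (φ j) s hs y
  -- the limit is not small at the hot spot
  have hnorm : ε ≤ ‖W (-1) 0‖ := by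
    refine ge_of_tendsto ((hpt (-1) (by norm_num) 0).norm) (Eventually.of_forall fun j => ?_)
    rw [hval]
    exact (hxk (φ j)).le
  -- ## slow variation transports `μ⋆` to every zoomed slice: `μ(c_j² s) → μ⋆`
  have hμj : ∀ s < 0, Tendsto (fun j => μ (c (φ j) ^ 2 * s)) atTop (𝓝 μstar) := by
    intro s hs
    have hs' : 0 < -s := neg_pos.2 hs
    have hc2φ : Tendsto (fun j => c (φ j) ^ 2) atTop atTop :=
      (tendsto_pow_atTop two_ne_zero).comp (hcinf.comp hφ.tendsto_atTop)
    -- `μ(c_j² s) − μ(c_j² · (−1)) → 0`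
    have h1 : Tendsto (fun j => μ (c (φ j) ^ 2 * s) - μ (c (φ j) ^ 2 * (-1))) atTop (𝓝 0) :=
      (hslow s (-1) hs (by norm_num)).comp hc2φ
    -- `μ(c_j² · (−1)) = μ(t_{φ j}) → μ⋆`
    have h2 : Tendsto (fun j => μ (c (φ j) ^ 2 * (-1))) atTop (𝓝 μstar) := by
      have h := hμtk.comp hφ.tendsto_atTop
      refine h.congr fun j => ?_
      simp only [Function.comp_apply]
      rw [hc2 (φ j)]
      ring_nf
    have h3 := h1.add h2
    rw [zero_add] at h3
    refine h3.congr fun j => ?_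
    ring
  -- ## the limit has CONSTANT shear `μ⋆` on every slice
  have hWshear : ∀ s < 0, ∀ y, ∀ b : Fin 3, b ≠ 2 →
      fderiv ℝ (W s) y (EuclideanSpace.single 2 1) b = μstar * fderiv ℝ (W s) y (EuclideanSpace.single b 1) 2 := by
    intro s hs y b hb
    have hentry : ∀ (e : EuclideanSpace ℝ (Fin 3)) (i : Fin 3),
        Tendsto (fun j => fderiv ℝ (vk (φ j) s) y e i) atTop (𝓝 (fderiv ℝ (W s) y e i)) := by
      intro e i
      have h1 : Tendsto (fun j => fderiv ℝ (vk (φ j) s) y e) atTop (𝓝 (fderiv ℝ (W s) y e)) :=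
        ((ContinuousLinearMap.apply ℝ (EuclideanSpace ℝ (Fin 3)) e).continuous.tendsto _).comp (hDpt s hs y)
      exact ((EuclideanSpace.proj (𝕜 := ℝ) i).continuous.tendsto _).comp h1
    have hL := hentry (EuclideanSpace.single 2 1) b
    have hR := hentry (EuclideanSpace.single b 1) 2
    have hR' : Tendsto (fun j => fderiv ℝ (vk (φ j) s) y (EuclideanSpace.single 2 1) b) atTop
        (𝓝 (μstar * fderiv ℝ (W s) y (EuclideanSpace.single b 1) 2)) :=
      ((hμj s hs).mul hR).congr fun j => (hvkshear (φ j) s hs y b hb).symm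
    exact tendsto_nhds_unique hL hR'
  -- ## so the limit vanishes (constant-shear stratum, every real `μ⋆`) — contradiction
  have hW0 : ∀ t < 0, ∀ x, W t x = 0 := by
    rcases lt_or_ge μstar 1 with hμ | hμ
    · exact eq_zero_of_constantShear hW.hasTypeITimeDecay hW.continuousOn_uncurry
        (fun s t hst ht x => hW.mild_eq_heatExtension hst ht x) (fun t ht => hW.isDivFree ht) hWpol hμ hWshear
    · exact eq_zero_of_proportionalShear hW.hasTypeITimeDecay hW.continuousOn_uncurry
        (fun s t hst ht x => hW.mild_eq_heatExtension hst ht x) (fun t ht => hW.isDivFree ht) hWpol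
        (zero_lt_one.trans_le hμ) fun s hs y => ⟨hWshear s hs y 0 (by decide), hWshear s hs y 1 (by decide)⟩
  have h0 : W (-1) 0 = 0 := hW0 (-1) (by norm_num) 0
  rw [h0, norm_zero] at hnorm
  linarith

/-- **THE CONSTANT-SHEAR DOOR AT `t = −∞`, slowly-varying form (profiles).**  Class + poloidal + all-slices proportional
shear with a slope bounded on a far-past tail and slowly varying under dilations (`μ(cs₁) − μ(cs₂) → 0` as `c → +∞`
for all `s₁, s₂ < 0`) ⇒ `v ≡ 0`. -/
theorem eq_zero_of_timeShear_slowlyVarying (hrate : HasTypeITimeDecay C v)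
    (hcont : ContinuousOn (uncurry v) (Iio (0 : ℝ) ×ˢ univ))
    (hmild : ∀ s t : ℝ, s < t → t < 0 → ∀ x,
      v t x = UnboundedOperators.heatExtension (v s) (t - s) x - oseenDuhamel 1 s v v t x)
    (hdiv : ∀ t < 0, VectorCalculus.IsDivFree (v t))
    (hpol : ∀ s < 0, ∀ y, ⟪curl (v s) y, EuclideanSpace.single 2 (1 : ℝ)⟫_ℝ = 0) {μ : ℝ → ℝ}
    (hslope : ∀ s < 0, ∀ y, ∀ b : Fin 3, b ≠ 2 →
      fderiv ℝ (v s) y (EuclideanSpace.single 2 1) b = μ s * fderiv ℝ (v s) y (EuclideanSpace.single b 1) 2)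
    {M T₀ : ℝ} (hbdd : ∀ τ < T₀, |μ τ| ≤ M)
    (hslow : ∀ s₁ s₂ : ℝ, s₁ < 0 → s₂ < 0 → Tendsto (fun c : ℝ => μ (c * s₁) - μ (c * s₂)) atTop (𝓝 0)) :
    ∀ t < 0, ∀ x, v t x = 0 :=
  eq_zero_of_tendsto_zero hrate hcont hmild
    (tendsto_zero_of_timeShear_slowlyVarying hrate hcont hmild hdiv hpol hslope hbdd hslow)

/-- The constant-shear door at `t = −∞`, slowly-varying form: not backward-singular. -/
theorem nonflatLiouville_of_timeShear_slowlyVarying (hrate : HasTypeITimeDecay C v)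
    (hcont : ContinuousOn (uncurry v) (Iio (0 : ℝ) ×ˢ univ))
    (hmild : ∀ s t : ℝ, s < t → t < 0 → ∀ x,
      v t x = UnboundedOperators.heatExtension (v s) (t - s) x - oseenDuhamel 1 s v v t x)
    (hdiv : ∀ t < 0, VectorCalculus.IsDivFree (v t))
    (hpol : ∀ s < 0, ∀ y, ⟪curl (v s) y, EuclideanSpace.single 2 (1 : ℝ)⟫_ℝ = 0) {μ : ℝ → ℝ}
    (hslope : ∀ s < 0, ∀ y, ∀ b : Fin 3, b ≠ 2 →
      fderiv ℝ (v s) y (EuclideanSpace.single 2 1) b = μ s * fderiv ℝ (v s) y (EuclideanSpace.single b 1) 2)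
    {M T₀ : ℝ} (hbdd : ∀ τ < T₀, |μ τ| ≤ M)
    (hslow : ∀ s₁ s₂ : ℝ, s₁ < 0 → s₂ < 0 → Tendsto (fun c : ℝ => μ (c * s₁) - μ (c * s₂)) atTop (𝓝 0)) :
    ¬ IsBackwardSingularPoint v 0 :=
  not_backwardSingular_of_zero (eq_zero_of_timeShear_slowlyVarying hrate hcont hmild hdiv hpol hslope hbdd hslow)

end Summit.NavierStokesRegularity.NavierStokesRegularity.Theorems.PoloidalWindowDoorPoloidalWindowRigidityTimeShearLimitPast

end
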